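import Summits.KontsevichZagierPeriods.Zeta5Search.Barrier.ConeGammaLemmaF7

/-!
# ζ(5) search — BARRIER: all 42 separable majorants in fractional-part form, and LEMMA F for the whole family

HONEST FRAMING (cell `pub-zeta5`): systematic search; no irrationality claim unless kernel-certified. MODEL objects under
Brown–Zudilin's (28)+(30) accounting ([BZ22] = arXiv:2210.03391; (28) observed, not proved): inequalities for BZ's saving
step function `𝒩 = torusN` on all of `ℝ⁸` and the resulting explicit elementary UPPER BOUNDS for the MODEL saving rate
`Φ = phi30`; nothing here is about any `γ` of record, the cone's supremum (C2 OPEN), S-E (CONJECTURED) or `ζ(5)`; no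
number or sentence of record moves; records in print UNMOVED. Prover P2 g24, sequel (C) to the item «LEMMA F IN THE
KERNEL» (plan INBOX l.9199): cert-2 g33's 42-member family `torusN_le_sepMajorant` (bit form) rewritten member by member
as `1 + Σ_m ε_m {ℓ_m(θ)}` with `Σ_m ε_m ℓ_m ≡ 0` — the shape LEMMA F (`phi30_le_of_sepBound`, file `ConeGammaLemmaF`)
consumes —, and LEMMA F applied to every member.

* `heavyInd_cast_eq`, `highInd_cast_eq`, `floor_fract_sub_cast_eq` — the three bit ↔ fractional-part identities of
  `ConeGammaSepMajorant`, solved for the bits; `sum_ite_pair_eq`, `sum_ite_single_eq` — bookkeeping of excluded indices.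
* **`torusN_le_sepMajorant_fract`** — for every `θ ∈ ℝ⁸` and every labelled pair `v ≠ w` of `{1..7}` (as `Fin 7`):
  `𝒩(θ) ≤ 1 + {θ₀+θ_v} + {θ₀−θ_v} + Σ_{i∉{v,w}} {θ_v−θ_i} − 2{θ_v+θ_w} − Σ_{j∉{v,w}} {θ_v+θ_j}
          + ({θ₃+θ₅}+{θ₄+θ₆}+{θ₁+θ₆}+{θ₁+θ₇}+{θ₄+θ₅}+{θ₂+θ₇}) − {θ₀−θ₂} − {θ₀−θ₃}`.
  The LINEAR PARTS CANCEL FOR ALL 42 MEMBERS: the coefficient of `x_v = {θ_v}` is `2 − deg_{P₀}(v) − [v ∈ {2,3}] = 0`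
  because the reference path `3–5–4–6–1–7–2` together with its two `U`-ends gives every vertex weight `2` (and `x₀`:
  `−1−1+2`, the others: `+1+1−2`). cert-2 g33's `torusN_le_F7` / `torusN_le_F6` are the members `(7,1)` / `(6,7)` after
  the reference-path terms `{θ₁+θ₇}`, `{θ₂+θ₇}` combine.
* `pairForm_le_of_dominant` — if `s_i ≤ s_v` for all `i ≠ w` (closed box), every one of the 28 forms is `≤ s₀ + s_v`.
* **`phi30_aOfS_le_boundG`**, **`phi30_le_boundG`** — LEMMA F FOR EVERY MEMBER: on the closed box, if `s_i ≤ s_v` for all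
  `i ∈ {1..7} ∖ {w}` (v carries the largest parameter outside `w`), then with `H = s₀ + s_v`
  `Φ ≤ H + Σ_m ε_m x_m log(H/x_m)` over the member's features (`x_m = ℓ_m(s) ≥ 0`). On the closed SORTED chamber the
  admissible members are `(7,w)`, `w = 1..6`, and `(6,7)`; `phi30_le_boundF7` / `_F6` of `ConeGammaLemmaF7` are `(7,1)` /
  `(6,7)`. DATA (seat file `alg/g42.py`, not a kernel statement): at the twelve reference directions of cert-2 g32's table
  the best admissible member is always F7 or F6; the other members matter for u-WINDOWS (sequel (D)).
-/

noncomputable section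

open Set MeasureTheory

namespace Summit.KontsevichZagierPeriods.Zeta5Search.Barrier.ConeGamma

/-! ### Bits as fractional parts; excluded indices -/

/-- `H(i,j) = x_i + x_j − {θ_i+θ_j}`. -/
theorem heavyInd_cast_eq (θ : Fin 8 → ℝ) (i j : Fin 8) :
    ((heavyInd θ i j : ℤ) : ℝ) = Int.fract (θ i) + Int.fract (θ j) - Int.fract (θ i + θ j) := by
  have h := fract_add_eq_heavyInd θ i j
  linarith

/-- `U(j) = {θ₀−θ_j} − x₀ + x_j`. -/
theorem highInd_cast_eq (θ : Fin 8 → ℝ) (j : Fin 8) :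
    ((highInd θ j : ℤ) : ℝ) = Int.fract (θ 0 - θ j) - Int.fract (θ 0) + Int.fract (θ j) := by
  have h := fract_zero_sub_eq_highInd θ j
  linarith

/-- `⌊x_p − x_q⌋ = x_p − x_q − {θ_p−θ_q}`. -/
theorem floor_fract_sub_cast_eq (θ : Fin 8 → ℝ) (p q : Fin 8) :
    ((⌊Int.fract (θ p) - Int.fract (θ q)⌋ : ℤ) : ℝ) = Int.fract (θ p) - Int.fract (θ q) - Int.fract (θ p - θ q) := by
  have h := fract_sub_eq θ p q
  linarith

/-- A sum over `Fin 7` with two excluded indices. -/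
theorem sum_ite_pair_eq {v w : Fin 7} (hvw : v ≠ w) (f : Fin 7 → ℝ) :
    (∑ i : Fin 7, if i = v ∨ i = w then (0 : ℝ) else f i) = ∑ i : Fin 7, f i - f v - f w := by
  have h1 : ∑ i : Fin 7, f i =
      (∑ i : Fin 7, if i = v ∨ i = w then (0 : ℝ) else f i) + ∑ i : Fin 7, (if i = v ∨ i = w then f i else 0) := by
    rw [← Finset.sum_add_distrib]
    refine Finset.sum_congr rfl fun i _ => ?_
    split_ifs <;> simp
  have h2 : (∑ i : Fin 7, if i = v ∨ i = w then f i else (0 : ℝ)) = f v + f w := by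
    rw [← Finset.sum_filter]
    have : (Finset.univ.filter fun i : Fin 7 => i = v ∨ i = w) = {v, w} := by
      ext i
      simp
    rw [this, Finset.sum_pair hvw]
  linarith

/-- A sum over `Fin 7` with one excluded index. -/
theorem sum_ite_single_eq (v : Fin 7) (f : Fin 7 → ℝ) :
    (∑ j : Fin 7, if j = v then (0 : ℝ) else f j) = ∑ j : Fin 7, f j - f v := by
  have h1 : ∑ j : Fin 7, f j = (∑ j : Fin 7, if j = v then (0 : ℝ) else f j) + ∑ j : Fin 7, (if j = v then f j else 0) := by
    rw [← Finset.sum_add_distrib]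
    refine Finset.sum_congr rfl fun j _ => ?_
    split_ifs <;> simp
  rw [Finset.sum_ite_eq' Finset.univ v f, if_pos (Finset.mem_univ v)] at h1
  linarith

/-! ### The 42 members in fractional-part form -/

/-- **ALL 42 SEPARABLE MAJORANTS IN FRACTIONAL-PART FORM.** For every `θ ∈ ℝ⁸` and every labelled pair of distinct vertices
`v ≠ w` of `{1..7}` (as `Fin 7`, vertex `j+1 ↔ j`):
`𝒩(θ) ≤ 1 + {θ₀+θ_v} + {θ₀−θ_v} + Σ_{i∉{v,w}} {θ_v−θ_i} − 2{θ_v+θ_w} − Σ_{j∉{v,w}} {θ_v+θ_j}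
 + ({θ₃+θ₅}+{θ₄+θ₆}+{θ₁+θ₆}+{θ₁+θ₇}+{θ₄+θ₅}+{θ₂+θ₇}) − {θ₀−θ₂} − {θ₀−θ₃}` (`{·} = Int.fract`; the linear parts of the bit
form cancel identically). -/
theorem torusN_le_sepMajorant_fract (θ : Fin 8 → ℝ) {v w : Fin 7} (hvw : v ≠ w) :
    (torusN θ : ℝ) ≤ 1 + Int.fract (θ 0 + θ v.succ) + Int.fract (θ 0 - θ v.succ)
      + (∑ i : Fin 7, if i = v ∨ i = w then (0 : ℝ) else Int.fract (θ v.succ - θ i.succ))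
      - 2 * Int.fract (θ v.succ + θ w.succ)
      - (∑ j : Fin 7, if j = v ∨ j = w then (0 : ℝ) else Int.fract (θ v.succ + θ j.succ))
      + (Int.fract (θ 3 + θ 5) + Int.fract (θ 4 + θ 6) + Int.fract (θ 1 + θ 6) + Int.fract (θ 1 + θ 7)
        + Int.fract (θ 4 + θ 5) + Int.fract (θ 2 + θ 7))
      - Int.fract (θ 0 - θ 2) - Int.fract (θ 0 - θ 3) := by
  have h := torusN_le_sepMajorant θ hvw
  have h' : (torusN θ : ℝ) ≤ ((1 - heavyInd θ 0 v.succ + highInd θ v.succ + heavyInd θ v.succ w.succ +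
        (∑ i : Fin 7, if i = v ∨ i = w then (0 : ℤ) else -⌊Int.fract (θ v.succ) - Int.fract (θ i.succ)⌋) +
        (∑ j : Fin 7, if j = v then (0 : ℤ) else heavyInd θ v.succ j.succ) -
      (heavyInd θ 3 5 + heavyInd θ 4 6 + heavyInd θ 1 6 + heavyInd θ 1 7 + heavyInd θ 4 5 + heavyInd θ 2 7 +
        highInd θ 2 + highInd θ 3) : ℤ) : ℝ) := by
    exact_mod_cast h
  push_cast at h'
  simp only [heavyInd_cast_eq, highInd_cast_eq, floor_fract_sub_cast_eq] at h'
  rw [sum_ite_pair_eq hvw (fun i => -(Int.fract (θ v.succ) - Int.fract (θ i.succ) -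
      Int.fract (θ v.succ - θ i.succ))),
    sum_ite_single_eq v (fun j => Int.fract (θ v.succ) + Int.fract (θ j.succ) - Int.fract (θ v.succ + θ j.succ))]
    at h'
  rw [sum_ite_pair_eq hvw (fun i => Int.fract (θ v.succ - θ i.succ)),
    sum_ite_pair_eq hvw (fun j => Int.fract (θ v.succ + θ j.succ))]
  simp only [Finset.sum_add_distrib, Finset.sum_sub_distrib, Finset.sum_neg_distrib, Finset.sum_const,
    Finset.card_univ, Fintype.card_fin, nsmul_eq_mul, Nat.cast_ofNat, sub_self, Int.fract_zero] at h' ⊢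
  have hS : ∑ i : Fin 7, Int.fract (θ i.succ) = Int.fract (θ 1) + Int.fract (θ 2) + Int.fract (θ 3) +
      Int.fract (θ 4) + Int.fract (θ 5) + Int.fract (θ 6) + Int.fract (θ 7) := by
    simp only [Fin.sum_univ_seven, Fin.succ_zero_eq_one, Fin.succ_one_eq_two, Fin.reduceSucc]
  linarith

/-! ### LEMMA F for every member -/

/-- If `v` carries the largest parameter outside `w` (`s_i ≤ s_v` for `i ≠ w`) on the closed box, every pair form —
i.e. every one of the 28 forms `h_k` — is at most `s₀ + s_v`. -/
theorem pairForm_le_of_dominant (s : Fin 8 → ℝ) (hlo : ∀ j : Fin 7, 0 ≤ s j.succ) (hhi : ∀ j : Fin 7, s j.succ ≤ s 0)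
    {v w : Fin 7} (hv : ∀ i : Fin 7, i ≠ w → s i.succ ≤ s v.succ) {p q : Fin 8} (hpq : p ≠ q) :
    pairForm s p q ≤ s 0 + s v.succ := by
  have hv0 : 0 ≤ s v.succ := hlo v
  unfold pairForm
  split_ifs with hp hq
  · -- `p = 0`: `s₀ − s_q ≤ s₀ + s_v`
    subst hp
    obtain ⟨j, rfl⟩ := Fin.exists_succ_eq.mpr (Ne.symm hpq)
    linarith [hlo j]
  · subst hq
    obtain ⟨i, rfl⟩ := Fin.exists_succ_eq.mpr (Ne.symm (Ne.symm hp))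
    linarith [hlo i]
  · obtain ⟨i, rfl⟩ := Fin.exists_succ_eq.mpr hp
    obtain ⟨j, rfl⟩ := Fin.exists_succ_eq.mpr hq
    have hij : i ≠ j := fun h => hpq (by rw [h])
    by_cases hi : i = w
    · subst hi
      have := hv j (Ne.symm hij)
      linarith [hhi i]
    · have := hv i hi
      linarith [hhi j]

/-- **LEMMA F FOR EVERY MEMBER OF THE 42-FAMILY (symmetric parameters).** On the closed box, for `v ≠ w` with `s_i ≤ s_v`
for all `i ≠ w`, and `H = s₀ + s_v`: `Φ(aOfS s) ≤ H + Σ_m ε_m x_m log(H/x_m)` over the features of member `(v,w)` of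
`torusN_le_sepMajorant_fract` (the first term `H·log 1` vanishes; kept for the term-by-term correspondence). -/
theorem phi30_aOfS_le_boundG (s : Fin 8 → ℝ) (h0 : 0 < s 0) (hlo : ∀ j : Fin 7, 0 ≤ s j.succ)
    (hhi : ∀ j : Fin 7, s j.succ ≤ s 0) {v w : Fin 7} (hvw : v ≠ w) (hv : ∀ i : Fin 7, i ≠ w → s i.succ ≤ s v.succ) :
    phi30 (aOfS s) ≤ (s 0 + s v.succ)
      + (s 0 + s v.succ) * Real.log ((s 0 + s v.succ) / (s 0 + s v.succ))
      + (s 0 - s v.succ) * Real.log ((s 0 + s v.succ) / (s 0 - s v.succ))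
      + (∑ i : Fin 7, if i = v ∨ i = w then (0 : ℝ) else
          (s v.succ - s i.succ) * Real.log ((s 0 + s v.succ) / (s v.succ - s i.succ)))
      - 2 * ((s v.succ + s w.succ) * Real.log ((s 0 + s v.succ) / (s v.succ + s w.succ)))
      - (∑ j : Fin 7, if j = v ∨ j = w then (0 : ℝ) else
          (s v.succ + s j.succ) * Real.log ((s 0 + s v.succ) / (s v.succ + s j.succ)))
      + ((s 3 + s 5) * Real.log ((s 0 + s v.succ) / (s 3 + s 5)) + (s 4 + s 6) * Real.log ((s 0 + s v.succ) / (s 4 + s 6))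
        + (s 1 + s 6) * Real.log ((s 0 + s v.succ) / (s 1 + s 6)) + (s 1 + s 7) * Real.log ((s 0 + s v.succ) / (s 1 + s 7))
        + (s 4 + s 5) * Real.log ((s 0 + s v.succ) / (s 4 + s 5)) + (s 2 + s 7) * Real.log ((s 0 + s v.succ) / (s 2 + s 7)))
      - (s 0 - s 2) * Real.log ((s 0 + s v.succ) / (s 0 - s 2))
      - (s 0 - s 3) * Real.log ((s 0 + s v.succ) / (s 0 - s 3)) := by
  have h1lo := hlo 0; have h2lo := hlo 1; have h3lo := hlo 2; have h4lo := hlo 3; have h5lo := hlo 4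
  have h6lo := hlo 5; have h7lo := hlo 6
  have h1hi := hhi 0; have h2hi := hhi 1; have h3hi := hhi 2; have h4hi := hhi 3; have h5hi := hhi 4
  have h6hi := hhi 5; have h7hi := hhi 6
  simp only [Fin.succ_zero_eq_one, Fin.succ_one_eq_two] at h1lo h2lo h1hi h2hi
  change 0 ≤ s 3 at h3lo; change 0 ≤ s 4 at h4lo; change 0 ≤ s 5 at h5lo; change 0 ≤ s 6 at h6lo
  change 0 ≤ s 7 at h7lo
  change s 3 ≤ s 0 at h3hi; change s 4 ≤ s 0 at h4hi; change s 5 ≤ s 0 at h5hi; change s 6 ≤ s 0 at h6hi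
  change s 7 ≤ s 0 at h7hi
  have hv0 : 0 ≤ s v.succ := hlo v
  have hvhi : s v.succ ≤ s 0 := hhi v
  have hw0 : 0 ≤ s w.succ := hlo w
  have hwhi : s w.succ ≤ s 0 := hhi w
  have hbox : BZBox (aOfS s) := by
    refine ⟨by rwa [sParam_aOfS], fun j => ⟨by rw [sParam_aOfS]; exact hlo j, by rw [sParam_aOfS]; exact hhi j⟩⟩
  set H : ℝ := s 0 + s v.succ with hHdef
  have hH : 0 < H := by rw [hHdef]; linarith
  have hpair : ∀ p q : Fin 8, p ≠ q → pairForm s p q ≤ H := fun p q hpq =>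
    pairForm_le_of_dominant s hlo hhi hv hpq
  -- features: 11 fixed ones, then the two `Fin 7`-indexed groups
  set xA : Fin 11 → ℝ := ![s 0 + s v.succ, s 0 - s v.succ, s v.succ + s w.succ, s 3 + s 5, s 4 + s 6, s 1 + s 6,
    s 1 + s 7, s 4 + s 5, s 2 + s 7, s 0 - s 2, s 0 - s 3] with hxA
  set εA : Fin 11 → ℝ := ![1, 1, -2, 1, 1, 1, 1, 1, 1, -1, -1] with hεA
  set xB : Fin 7 → ℝ := fun i => if i = v ∨ i = w then 0 else s v.succ - s i.succ with hxB
  set xC : Fin 7 → ℝ := fun j => if j = v ∨ j = w then 0 else s v.succ + s j.succ with hxC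
  set x : Fin 11 ⊕ (Fin 7 ⊕ Fin 7) → ℝ := Sum.elim xA (Sum.elim xB xC) with hx
  set ε : Fin 11 ⊕ (Fin 7 ⊕ Fin 7) → ℝ := Sum.elim εA (Sum.elim (fun _ => 1) (fun _ => -1)) with hε
  have hh : ∀ k : Fin 28, h28 (aOfS s) k ≤ H := fun k => by
    rw [← phiForm, phiForm_eq]
    exact hpair _ _ (fstIdx_ne_sndIdx k)
  have h35 : s 3 + s 5 ≤ H := by have := hpair 3 5 (by decide); simpa [pairForm] using this
  have h46 : s 4 + s 6 ≤ H := by have := hpair 4 6 (by decide); simpa [pairForm] using this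
  have h16 : s 1 + s 6 ≤ H := by have := hpair 1 6 (by decide); simpa [pairForm] using this
  have h17 : s 1 + s 7 ≤ H := by have := hpair 1 7 (by decide); simpa [pairForm] using this
  have h45 : s 4 + s 5 ≤ H := by have := hpair 4 5 (by decide); simpa [pairForm] using this
  have h27 : s 2 + s 7 ≤ H := by have := hpair 2 7 (by decide); simpa [pairForm] using this
  have hx0 : ∀ m ∈ (Finset.univ : Finset (Fin 11 ⊕ (Fin 7 ⊕ Fin 7))), 0 ≤ x m := by
    rintro (m | m | m) _
    · simp only [hx, Sum.elim_inl]
      fin_cases m <;> simp [hxA] <;> linarith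
    · simp only [hx, Sum.elim_inr, Sum.elim_inl, hxB]
      split_ifs with hm
      · exact le_rfl
      · have := hv m (fun h => hm (Or.inr h)); linarith
    · simp only [hx, Sum.elim_inr, hxC]
      split_ifs with hm
      · exact le_rfl
      · linarith [hlo m]
  have hxH : ∀ m ∈ (Finset.univ : Finset (Fin 11 ⊕ (Fin 7 ⊕ Fin 7))), x m ≤ H := by
    rintro (m | m | m) _
    · simp only [hx, Sum.elim_inl]
      fin_cases m <;> simp [hxA] <;> linarith
    · simp only [hx, Sum.elim_inr, Sum.elim_inl, hxB]
      split_ifs with hm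
      · exact hH.le
      · rw [hHdef]; linarith [hlo m]
    · simp only [hx, Sum.elim_inr, hxC]
      split_ifs with hm
      · exact hH.le
      · have := hv m (fun h => hm (Or.inr h)); rw [hHdef]; linarith
  have hS : ∑ i : Fin 7, s i.succ = s 1 + s 2 + s 3 + s 4 + s 5 + s 6 + s 7 := by
    simp only [Fin.sum_univ_seven, Fin.succ_zero_eq_one, Fin.succ_one_eq_two, Fin.reduceSucc]
  -- the fixed group, expanded (only `Fin 11` sums occur in these three identities)
  have hAlin : ∑ m : Fin 11, εA m * xA m = (s 0 + s v.succ) + (s 0 - s v.succ) - 2 * (s v.succ + s w.succ)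
      + (s 3 + s 5) + (s 4 + s 6) + (s 1 + s 6) + (s 1 + s 7) + (s 4 + s 5) + (s 2 + s 7)
      - (s 0 - s 2) - (s 0 - s 3) := by
    simp only [Fin.sum_univ_succ, Fin.sum_univ_zero, hxA, hεA, Matrix.cons_val_zero, Matrix.cons_val_succ]
    ring
  have hAfr : ∀ u : ℝ, ∑ m : Fin 11, εA m * Int.fract (u * xA m) =
      Int.fract (u * (s 0 + s v.succ)) + Int.fract (u * (s 0 - s v.succ)) - 2 * Int.fract (u * (s v.succ + s w.succ))
      + Int.fract (u * (s 3 + s 5)) + Int.fract (u * (s 4 + s 6)) + Int.fract (u * (s 1 + s 6))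
      + Int.fract (u * (s 1 + s 7)) + Int.fract (u * (s 4 + s 5)) + Int.fract (u * (s 2 + s 7))
      - Int.fract (u * (s 0 - s 2)) - Int.fract (u * (s 0 - s 3)) := by
    intro u
    simp only [Fin.sum_univ_succ, Fin.sum_univ_zero, hxA, hεA, Matrix.cons_val_zero, Matrix.cons_val_succ]
    ring
  have hAlog : ∑ m : Fin 11, εA m * (xA m * Real.log (H / xA m)) =
      (s 0 + s v.succ) * Real.log (H / (s 0 + s v.succ)) + (s 0 - s v.succ) * Real.log (H / (s 0 - s v.succ))
      - 2 * ((s v.succ + s w.succ) * Real.log (H / (s v.succ + s w.succ)))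
      + (s 3 + s 5) * Real.log (H / (s 3 + s 5)) + (s 4 + s 6) * Real.log (H / (s 4 + s 6))
      + (s 1 + s 6) * Real.log (H / (s 1 + s 6)) + (s 1 + s 7) * Real.log (H / (s 1 + s 7))
      + (s 4 + s 5) * Real.log (H / (s 4 + s 5)) + (s 2 + s 7) * Real.log (H / (s 2 + s 7))
      - (s 0 - s 2) * Real.log (H / (s 0 - s 2)) - (s 0 - s 3) * Real.log (H / (s 0 - s 3)) := by
    simp only [Fin.sum_univ_succ, Fin.sum_univ_zero, hxA, hεA, Matrix.cons_val_zero, Matrix.cons_val_succ]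
    ring
  -- the two `Fin 7` groups
  have hBlin : ∑ i : Fin 7, (1 : ℝ) * xB i = ∑ i : Fin 7, (s v.succ - s i.succ) - 0 - (s v.succ - s w.succ) := by
    rw [← sub_self (s v.succ), ← sum_ite_pair_eq hvw (fun i => s v.succ - s i.succ)]
    refine Finset.sum_congr rfl fun i _ => ?_
    simp only [hxB, one_mul]
  have hClin : ∑ j : Fin 7, (-1 : ℝ) * xC j =
      -(∑ j : Fin 7, (s v.succ + s j.succ) - (s v.succ + s v.succ) - (s v.succ + s w.succ)) := by
    rw [← sum_ite_pair_eq hvw (fun j => s v.succ + s j.succ), ← Finset.sum_neg_distrib]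
    refine Finset.sum_congr rfl fun j _ => ?_
    simp only [hxC]
    split_ifs <;> ring
  have hBfr : ∀ u : ℝ, ∑ i : Fin 7, (1 : ℝ) * Int.fract (u * xB i) =
      ∑ i : Fin 7, if i = v ∨ i = w then (0 : ℝ) else Int.fract (u * (s v.succ - s i.succ)) := by
    intro u
    refine Finset.sum_congr rfl fun i _ => ?_
    simp only [hxB]
    split_ifs <;> simp
  have hCfr : ∀ u : ℝ, ∑ j : Fin 7, (-1 : ℝ) * Int.fract (u * xC j) =
      -(∑ j : Fin 7, if j = v ∨ j = w then (0 : ℝ) else Int.fract (u * (s v.succ + s j.succ))) := by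
    intro u
    rw [← Finset.sum_neg_distrib]
    refine Finset.sum_congr rfl fun j _ => ?_
    simp only [hxC]
    split_ifs <;> simp
  have hBlog : ∑ i : Fin 7, (1 : ℝ) * (xB i * Real.log (H / xB i)) =
      ∑ i : Fin 7, if i = v ∨ i = w then (0 : ℝ) else (s v.succ - s i.succ) * Real.log (H / (s v.succ - s i.succ)) := by
    refine Finset.sum_congr rfl fun i _ => ?_
    simp only [hxB]
    split_ifs <;> simp
  have hClog : ∑ j : Fin 7, (-1 : ℝ) * (xC j * Real.log (H / xC j)) =
      -(∑ j : Fin 7, if j = v ∨ j = w then (0 : ℝ) else (s v.succ + s j.succ) * Real.log (H / (s v.succ + s j.succ))) := by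
    rw [← Finset.sum_neg_distrib]
    refine Finset.sum_congr rfl fun j _ => ?_
    simp only [hxC]
    split_ifs <;> simp
  have hlin : ∑ m ∈ (Finset.univ : Finset (Fin 11 ⊕ (Fin 7 ⊕ Fin 7))), ε m * x m = 0 := by
    rw [Fintype.sum_sum_type, Fintype.sum_sum_type]
    simp only [hx, hε, Sum.elim_inl, Sum.elim_inr]
    rw [hAlin, hBlin, hClin]
    simp only [Finset.sum_sub_distrib, Finset.sum_add_distrib, Finset.sum_const, Finset.card_univ, Fintype.card_fin,
      nsmul_eq_mul, Nat.cast_ofNat, hS]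
    ring
  have hN : ∀ u : ℝ, 1 / H ≤ u → (savingN (aOfS s) u : ℝ) ≤
      1 + ∑ m ∈ (Finset.univ : Finset (Fin 11 ⊕ (Fin 7 ⊕ Fin 7))), ε m * Int.fract (u * x m) := by
    intro u _
    rw [savingN_eq_torusN_of_BZBox hbox, sParam_aOfS]
    have hF := torusN_le_sepMajorant_fract (u • s) hvw
    simp only [Pi.smul_apply, smul_eq_mul, ← mul_add, ← mul_sub] at hF
    rw [Fintype.sum_sum_type, Fintype.sum_sum_type]
    simp only [hx, hε, Sum.elim_inl, Sum.elim_inr]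
    rw [hAfr u, hBfr u, hCfr u]
    linarith
  have key := phi30_le_of_sepBound hbox hH hh Finset.univ ε x 1 hx0 hxH hlin hN
  rw [Fintype.sum_sum_type, Fintype.sum_sum_type] at key
  simp only [hx, hε, Sum.elim_inl, Sum.elim_inr] at key
  rw [hAlog, hBlog, hClog, one_mul] at key
  rw [hHdef] at key
  linarith

/-- **LEMMA F FOR EVERY MEMBER OF THE 42-FAMILY (directions).** For `a` in the closed box, `v ≠ w`, `s_i ≤ s_v` for all
`i ≠ w` (`s = sParam a`), and `H = s₀ + s_v`: `Φ(a) ≤ H + Σ_m ε_m x_m log(H/x_m)` over the features of member `(v,w)`.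
On the closed sorted chamber the admissible `(v,w)` are `(7,·)` and `(6,7)`. -/
theorem phi30_le_boundG {a : Dir} (ha : BZBox a) {v w : Fin 7} (hvw : v ≠ w)
    (hv : ∀ i : Fin 7, i ≠ w → sParam a i.succ ≤ sParam a v.succ) :
    phi30 a ≤ (sParam a 0 + sParam a v.succ)
      + (sParam a 0 + sParam a v.succ) * Real.log ((sParam a 0 + sParam a v.succ) / (sParam a 0 + sParam a v.succ))
      + (sParam a 0 - sParam a v.succ) * Real.log ((sParam a 0 + sParam a v.succ) / (sParam a 0 - sParam a v.succ))
      + (∑ i : Fin 7, if i = v ∨ i = w then (0 : ℝ) else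
          (sParam a v.succ - sParam a i.succ) *
            Real.log ((sParam a 0 + sParam a v.succ) / (sParam a v.succ - sParam a i.succ)))
      - 2 * ((sParam a v.succ + sParam a w.succ) *
          Real.log ((sParam a 0 + sParam a v.succ) / (sParam a v.succ + sParam a w.succ)))
      - (∑ j : Fin 7, if j = v ∨ j = w then (0 : ℝ) else
          (sParam a v.succ + sParam a j.succ) *
            Real.log ((sParam a 0 + sParam a v.succ) / (sParam a v.succ + sParam a j.succ)))
      + ((sParam a 3 + sParam a 5) * Real.log ((sParam a 0 + sParam a v.succ) / (sParam a 3 + sParam a 5))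
        + (sParam a 4 + sParam a 6) * Real.log ((sParam a 0 + sParam a v.succ) / (sParam a 4 + sParam a 6))
        + (sParam a 1 + sParam a 6) * Real.log ((sParam a 0 + sParam a v.succ) / (sParam a 1 + sParam a 6))
        + (sParam a 1 + sParam a 7) * Real.log ((sParam a 0 + sParam a v.succ) / (sParam a 1 + sParam a 7))
        + (sParam a 4 + sParam a 5) * Real.log ((sParam a 0 + sParam a v.succ) / (sParam a 4 + sParam a 5))
        + (sParam a 2 + sParam a 7) * Real.log ((sParam a 0 + sParam a v.succ) / (sParam a 2 + sParam a 7)))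
      - (sParam a 0 - sParam a 2) * Real.log ((sParam a 0 + sParam a v.succ) / (sParam a 0 - sParam a 2))
      - (sParam a 0 - sParam a 3) * Real.log ((sParam a 0 + sParam a v.succ) / (sParam a 0 - sParam a 3)) := by
  have h := phi30_aOfS_le_boundG (sParam a) ha.1 (fun j => (ha.2 j).1) (fun j => (ha.2 j).2) hvw hv
  rwa [aOfS_sParam] at h

end Summit.KontsevichZagierPeriods.Zeta5Search.Barrier.ConeGamma

end
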